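import Literature.MathematicalPhysics.QuantumFieldTheory.Balaban1983to89.B9Cor35GpDirAtCubeLetters
import Literature.MathematicalPhysics.QuantumFieldTheory.Balaban1983to89.B9Eq360PadDeltaCubeYAgree

/-!
# `Balaban1983to89.B9Cor36GpDirExtAtField` — [Balaban1985BackgroundPropagators] COROLLARY 3.6 p. 408 AT ONE COVER CUBE ON ROAD P4: THEOREM 3.4's EXTENSION AT THE
# PADDED DIRICHLET LETTER AND THE SMALL FIELD `Ṽ = Uᵘ·𝟙[bond ⊂ Ω₀(□)]` IS `conj b(η²(padΔ_{□,Ω₀}(Ṽ))⁻¹)` (uniqueness of the two-sided inverse), `padΔ_{□,Ω₀}(Ṽ) =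
# padΔ_{□,Ω₀}(Uᵘ)` IS A UNIT, `G′_□(Ṽ) = G′_□(Uᵘ)`, AND THE CUBE-SIDE PACKAGE (base entries, (3.37) readings, (3.59) sizes at def-Y's `parKnitCubeY`, the two
# transfer clauses at one rate) — r05's FILE 7b-A `B9Cor36GpCubeExtAtV.gp_cube_at_locCfg` RE-PRESSED AT PRINT's DIRICHLET LETTER WITH THE CUBE-LEVEL KNIT LEGS (β)
# — sub-row G-B9-LETTERS (site sector), seat dag-n06-c g32 UNIT 7

statement-level skeleton of published theorems with citation tags; proofs where landed; nothing here is a claim about the Yang–Mills mass gap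

CITATION HEADER (lean-in-tree rule).  B9 = T. Bałaban, *Propagators for lattice gauge theories in a background field*, Commun. Math. Phys. **99** (1985)
389–434 [Balaban1985BackgroundPropagators] (held `paper:balaban1985-cmp99-background-propagators`; journal page = PDF page + 388): Cor. 3.6 p. 408 «If a
configuration U satisfies (3.35) … then Theorems 3.1–3.3 hold for the operators … constructed for the sequence {Ω_j}. This follows from Corollary 3.5 applied to
the configuration U′ = Uᵘ, and we have to recall only that all the results of these theorems are gauge invariant»; p. 408 l. 1–6 («Uᵘ = e^{iηA} … satisfies (3.37)
for the sequence … with U = 1 and α₁ = O(1)Mα₀»); p. 408 (last lines)–p. 409 l. 5 («Ω₀(□) ⊂ □⁵ … the cube □⁵ is contained in one of the cubes for which this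
condition holds … G′_□(U), … satisfy all the inequalities of Theorems 3.1–3.3»); Thm 3.4 p. 400 («G′(U′U) = (Δ′_a(U′U))⁻¹ exists»); (3.64)–(3.65) p. 402;
Cor. 3.5 p. 407; Thm 3.1 (3.42) p. 397; (3.35)–(3.37) p. 396; (3.58)–(3.60) p. 402; p. 394 l. 24–33.  Rows B9.Cor3.6 × B9.Thm3.4 × B9.Cor3.5 (cells only).

WHY THIS FILE (road P4 of the N06 h36b campaign; UNITS 1–6 of this seat).  UNIT 2's `cor35_GpDir_cube` (Sect. B's engine at the padded Dirichlet letter, `U = 1`)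
produces the ABSTRACT extension `gPrimeExtEnd Gp (V′Gp)` with its two inverse laws against `Δp − V′` and two transfer clauses; the consumers need these at the GENUINE
padded inverse `(padΔ_{□,Ω₀}(Ṽ))⁻¹` at the small field of a (3.35) datum covering `Ω₀(□)`, together with the base entries at the same `(B_G, δ₀)`, the (3.37)
readings of the cut potential (UNIT 5) and the (3.59) sizes of the cube kernels at the knit legs (UNIT 4).  §1: the letters `VpDirK`, `GextDirK`, `GpDirVK` and
★★`GextDirK_eq_GpDirVK` (two two-sided inverses of `Δp − V′ = conj b(η⁻²padΔ(Ṽ))` — UNIT 3's padded (3.60) with UNIT 6's compression — coincide); §2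
★★★`gpDir_cube_at_field`: everything at the datum, with the small field traded for `Uᵘ` on the padded letters (UNIT 6).

WHAT IS PROVED (3 `def`s with bodies — `VpDirK`, `GextDirK`, `GpDirVK`; 0 sorry; 0 new named facts; standard axioms): `DpDirK_sub_VpDirK`, `GpDirVK_mul_sub`,
`sub_mul_GpDirVK`, ★★`GextDirK_eq_GpDirVK`, `one_le_levCubeY_of_eta_lt`, ★★★`gpDir_cube_at_field` (`𝔸 = M_N(ℂ)`: (i) `IsUnit padΔ_{□,Ω₀}(parKnitCubeY)(Ṽ)`,
`GextDirK = GpDirVK`, `padΔ(Ṽ) = padΔ(Uᵘ)`, `IsUnit padΔ(Uᵘ)`, `G′_□(Ṽ) = G′_□(Uᵘ)`; (ii) the located thresholds; (iii) the base entries for `GpDirK`; (iv) the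
(3.37) readings of `Ã` at the cube lengths and the (3.59) sizes at `parKnitCubeY` (`C_q^K`); (v) the two transfer clauses for `GpDirVK` at `(B, 9δ₀/10)`),
★`hasMajorant_GpDirVK` ((3.42)₁ for `conj b(η²(padΔ(Ṽ))⁻¹)`, `X := 1`).

PROOF.  Ours (bookkeeping around the printed Sect. B route), r05's assembly with the letters exchanged; the datum box, the geometry `hS2` (2-step stencils of
positive-level rows inside `Ω₀(□)`), the smallness `2CΛ² ≤ min(a₁, ¼)` and p06's window numerics for the knit legs are DISPLAYED hypotheses.

HONEST SCOPE / NOT CLAIMED.  `𝔸 = M_N(ℂ)` in §2 (UNIT 4's averaging machinery); the (3.42)₂₋₄ entries with the derivatives AT `Ṽ` and the compression to def-Y's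
`G′_□ = Ω₀(padΔ)⁻¹Ω₀` (boundary commutators) are the next unit; the datum box `Q ⊇ chart⁻¹(Ω₀(□))` is NOT supplied here (print: `Ω₀(□) ⊂ □⁵ ⊂` a (3.35) cube of 12 big
blocks — vs the tree's class `IsCube396` (n ≤ 10) and the wrapping top levels of the record: LOCATED-32); nothing on `d = 4`, the continuum, reflection positivity or
the mass gap; NOT a node discharge; no row head changes.

RELATED IN THE TREE, NOT DUPLICATED: r05's `B9Cor36GpCubeExtAtV` (same package for the torus-levelled letter `GpCubeY` at `parSymY` and the cut field `χ̃_□A`);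
`B9Cor36GpCubeIsUnit`; this seat's UNITS 1–6 (used by name).
-/

noncomputable section

namespace Literature.MathematicalPhysics.QuantumFieldTheory.Balaban1983to89.B9Cor36GpDirExtAtField

open Literature.MathematicalPhysics.QuantumFieldTheory.Balaban1983to89
open Literature.MathematicalPhysics.QuantumFieldTheory.Balaban1983to89.B6RandomWalk (HasMajorant hasMajorant_mono)
open Literature.MathematicalPhysics.QuantumFieldTheory.Balaban1983to89.B9Thm34Ext (toB6)
open Literature.MathematicalPhysics.QuantumFieldTheory.Balaban1983to89.B9Eq352DivFormLetters (conj conj_sub)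
open Literature.MathematicalPhysics.QuantumFieldTheory.Balaban1983to89.B9Eq352GradLetters (diffLetter)
open Literature.MathematicalPhysics.QuantumFieldTheory.Balaban1983to89.B9Eq360Vprime (gPrimeExtEnd)
open Literature.MathematicalPhysics.QuantumFieldTheory.Balaban1983to89.B9Eq360VprimeLetters (vPrimeConc)
open Literature.MathematicalPhysics.QuantumFieldTheory.Balaban1983to89.B9Eq39Adjoint (fluct covD covDstar)
open Literature.MathematicalPhysics.QuantumFieldTheory.Balaban1983to89.B9Eq352DivForm (tauB)
open Literature.MathematicalPhysics.QuantumFieldTheory.Balaban1983to89.B6KLevelCensusIndexV1 (KIdx kGeo)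
open Literature.MathematicalPhysics.QuantumFieldTheory.Balaban1983to89.B6Cover236MultiLevelBlocks (cubes)
open Literature.MathematicalPhysics.QuantumFieldTheory.Balaban1983to89.B6GlobalChartV1 (PV boxEquiv)
open Literature.MathematicalPhysics.QuantumFieldTheory.Balaban1983to89.B6Geom246MultiLevelBoxL0 (blkOf)
open Literature.MathematicalPhysics.QuantumFieldTheory.Balaban1983to89.B9BackgroundsKLevelV1 (shiftsV1)
open Literature.MathematicalPhysics.QuantumFieldTheory.Balaban1983to89.B9Eq360DeltaPrimeAY (mulY AfldY chartA)
open Literature.MathematicalPhysics.QuantumFieldTheory.Balaban1983to89.B9Eq360DeltaPrimeACubeY (blkCubeY kQCubeY sQCubeY kFCubeY sFCubeY levCubeY_eq)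
open Literature.MathematicalPhysics.QuantumFieldTheory.Balaban1983to89.B9CubeLettersOpsL0 (oddMh cubeFamY levCubeY deltaPrimeACubeY)
open Literature.MathematicalPhysics.QuantumFieldTheory.Balaban1983to89.B9CubeLettersBondOpsL0 (BlkCubeY)
open Literature.MathematicalPhysics.QuantumFieldTheory.Balaban1983to89.B9CubeGeometryInputs (geoCK geoCK_len geoCK_eta geoCK_eta_pos geoCK_len_blkCubeY RM1 N1)
open Literature.MathematicalPhysics.QuantumFieldTheory.Balaban1983to89.B9Cor35GpCubeInputsAtOne (wK cfunK eta_ne_zero conj_one')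
open Literature.MathematicalPhysics.QuantumFieldTheory.Balaban1983to89.B9Cor35GpDirInputsAtOne (dirDomY DpDirK GpDirK)
open Literature.MathematicalPhysics.QuantumFieldTheory.Balaban1983to89.B9Cor35GpDirAtCubeLetters (cor35_GpDir_cube)
open Literature.MathematicalPhysics.QuantumFieldTheory.Balaban1983to89.B9Cor36CubeCutoffs (scaleLen_levCubeY_bounds)
open Literature.MathematicalPhysics.QuantumFieldTheory.Balaban1983to89.B9Eq359CubeKernelsAtOne (ownLevel_of_blockwise isUnit_of_conj_laws)
open Literature.MathematicalPhysics.QuantumFieldTheory.Balaban1983to89.B9Eq359CubeKernelsKnitAtOne (CqK CqK_nonneg norm_kFCubeY_parKnitCubeY_one_le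
  norm_sFCubeY_parKnitCubeY_one_le)
open Literature.MathematicalPhysics.QuantumFieldTheory.Balaban1983to89.B9Eq337CutFieldDirY (cutFldS cutCfgS readings337_cutFldS)
open Literature.MathematicalPhysics.QuantumFieldTheory.Balaban1983to89.B9Eq360PadDeltaCubeY (DpDirK_sub_conj_vPrimeConc)
open Literature.MathematicalPhysics.QuantumFieldTheory.Balaban1983to89.B9Eq360PadDeltaCubeYAgree (compr_sub_compr_eq_cutCfgS padDeltaCubeY_cutCfgS_eq_gaugeY
  GpDirY_cutCfgS_eq_gaugeY)
open Literature.MathematicalPhysics.QuantumFieldTheory.Balaban1983to89.B9CubeSequence408Mirrors (mem_dirDomC_of_lev_pos)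
open Literature.MathematicalPhysics.QuantumFieldTheory.Balaban1983to89.B7Prop2Explicit (C0 c2')
open Literature.MathematicalPhysics.QuantumFieldTheory.Balaban1983to89.B7Prop3Flat (c3)
open Literature.MathematicalPhysics.QuantumFieldTheory.Balaban1983to89.Node00 (SiteY CfgY GaugeY SiteParY toKT shiftY gaugeY UboxY)
open Literature.MathematicalPhysics.QuantumFieldTheory.Balaban1983to89.Node00.OpsYCubeDirInverse (padDeltaCubeY GpDirY)
open Literature.MathematicalPhysics.QuantumFieldTheory.Balaban1983to89.Node00.OpsYCubeKnitPar (parKnitCubeY parKnitCubeY_one)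
open scoped Matrix

variable {d ℓ : ℕ} {hd : 1 ≤ d + 1} {hL : Odd (ℓ + 1) ∧ 1 < ℓ + 1} {b₀ b₁ : ℝ}

/-! ## §1  The letters at the small field `Ṽ = e^{iηÃ}·1` and the identification `G′_□,ext = conj b(η²(padΔ_{□,Ω₀}(Ṽ))⁻¹)` -/

section Letters

variable {𝔸 : Type} [NormedRing 𝔸] [NormedAlgebra ℂ 𝔸] [CompleteSpace 𝔸]
variable {ι : Type} [Fintype ι] (b : Module.Basis ι ℝ 𝔸)
variable (i : KIdx d ℓ hd hL b₀ b₁) (c : ↥(cubes (toKT i).D.toDomains)) (par : SiteParY 𝔸 i)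

/-- **`V′_□(Ã)` — the concrete (3.60) letter AT THE DIRICHLET CUBE for the cut potential `Ã = A·𝟙[bond ⊂ Ω₀(□)]`**, on r05 FILE 1's cube kernels at the base `U = 1` and
the small field `Ṽ = e^{iηÃ}·1`, in real coordinates. [cite: Balaban1985BackgroundPropagators, (3.60) p.402, (3.57)–(3.59) pp.401–402, Cor. 3.6 p.408] -/
def VpDirK (A : AfldY 𝔸 i) : Module.End ℝ (SiteY i × ι → ℝ) :=
  conj b (vPrimeConc (shiftY i) (fun _ _ => (1 : 𝔸ˣ)) (geoCK i c).eta (chartA i (cutFldS i (dirDomY i c) A)) (blkCubeY i c)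
    (kQCubeY i c par (fun _ _ => 1)) (kFCubeY i c par (fun _ _ => 1) (cutCfgS i (dirDomY i c) (kGeo i).eta A)) (sQCubeY i c par (fun _ _ => 1))
    (sFCubeY i c par (fun _ _ => 1) (cutCfgS i (dirDomY i c) (kGeo i).eta A)) (cfunK i c))

/-- **`G′_□,ext` — THEOREM 3.4's EXTENSION AT THE PADDED DIRICHLET LETTER** for the cut potential: the operator series `Gp(1 − V′Gp)⁻¹` of (3.64) with
`Gp = conj b(η²(padΔ_{□,Ω₀}(1))⁻¹)`. [cite: Balaban1985BackgroundPropagators, (3.64)–(3.65) p.402, Thm 3.4 p.400, Cor. 3.6 p.408] -/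
def GextDirK (A : AfldY 𝔸 i) : Module.End ℝ (SiteY i × ι → ℝ) := gPrimeExtEnd (GpDirK b i c par) (VpDirK b i c par A * GpDirK b i c par)

/-- **`conj b(η²(padΔ_{□,Ω₀}(Ṽ))⁻¹)` — THE PADDED DIRICHLET INVERSE AT THE SMALL FIELD**, print's units, real coordinates; its `Ω₀`-compression is def-Y's
`G′_□(Ṽ) = GpDirY … Ω₀(□) Ṽ`. [cite: Balaban1985BackgroundPropagators, p.394 («Its inverse is denoted by G′»), p.409 l.1–5 («G′_□(U)»), Thm 3.4 p.400] -/
def GpDirVK (A : AfldY 𝔸 i) : Module.End ℝ (SiteY i × ι → ℝ) :=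
  conj b (((kGeo i).eta ^ 2) • (Ring.inverse (padDeltaCubeY i c par (dirDomY i c) (cutCfgS i (dirDomY i c) (kGeo i).eta A))).restrictScalars ℝ)

/-- `Δp − V′_□(Ã) = conj b(η⁻²padΔ_{□,Ω₀}(Ṽ))` given the `Ω₀`-compression of the variation (UNIT 3 in this file's letters). [cite: Balaban1985BackgroundPropagators, (3.60) p.402, p.394] -/
theorem DpDirK_sub_VpDirK (A : AfldY 𝔸 i)
    (h : Node00.OpsYLocalInverse.cubeProjY i (dirDomY i c) *
        (deltaPrimeACubeY i c par (fun _ _ => 1) - deltaPrimeACubeY i c par (cutCfgS i (dirDomY i c) (kGeo i).eta A)) *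
        Node00.OpsYLocalInverse.cubeProjY i (dirDomY i c) =
      deltaPrimeACubeY i c par (fun _ _ => 1) - deltaPrimeACubeY i c par (cutCfgS i (dirDomY i c) (kGeo i).eta A)) :
    DpDirK b i c par - VpDirK b i c par A =
      conj b ((((kGeo i).eta ^ 2)⁻¹) • (padDeltaCubeY i c par (dirDomY i c) (cutCfgS i (dirDomY i c) (kGeo i).eta A)).restrictScalars ℝ) :=
  DpDirK_sub_conj_vPrimeConc b i c par (cutFldS i (dirDomY i c) A) h

/-- `conj b(η²(padΔ(Ṽ))⁻¹)·(Δp − V′_□) = 1` when `padΔ_{□,Ω₀}(Ṽ)` is a unit. [cite: Balaban1985BackgroundPropagators, p.394, Thm 3.4 p.400] -/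
theorem GpDirVK_mul_sub (A : AfldY 𝔸 i)
    (h : Node00.OpsYLocalInverse.cubeProjY i (dirDomY i c) *
        (deltaPrimeACubeY i c par (fun _ _ => 1) - deltaPrimeACubeY i c par (cutCfgS i (dirDomY i c) (kGeo i).eta A)) *
        Node00.OpsYLocalInverse.cubeProjY i (dirDomY i c) =
      deltaPrimeACubeY i c par (fun _ _ => 1) - deltaPrimeACubeY i c par (cutCfgS i (dirDomY i c) (kGeo i).eta A))
    (hunit : IsUnit (padDeltaCubeY i c par (dirDomY i c) (cutCfgS i (dirDomY i c) (kGeo i).eta A))) :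
    GpDirVK b i c par A * (DpDirK b i c par - VpDirK b i c par A) = 1 := by
  have hη2 : ((kGeo i).eta ^ 2 : ℝ) ≠ 0 := pow_ne_zero 2 (eta_ne_zero i)
  rw [DpDirK_sub_VpDirK b i c par A h, GpDirVK, ← B9Eq352DivFormLetters.conj_mul, smul_mul_smul_comm, mul_inv_cancel₀ hη2, one_smul, Module.End.mul_eq_comp,
    ← LinearMap.restrictScalars_comp, ← Module.End.mul_eq_comp, Ring.inverse_mul_cancel _ hunit]
  exact conj_one' b

/-- `(Δp − V′_□)·conj b(η²(padΔ(Ṽ))⁻¹) = 1` when `padΔ_{□,Ω₀}(Ṽ)` is a unit. [cite: Balaban1985BackgroundPropagators, p.394, Thm 3.4 p.400] -/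
theorem sub_mul_GpDirVK (A : AfldY 𝔸 i)
    (h : Node00.OpsYLocalInverse.cubeProjY i (dirDomY i c) *
        (deltaPrimeACubeY i c par (fun _ _ => 1) - deltaPrimeACubeY i c par (cutCfgS i (dirDomY i c) (kGeo i).eta A)) *
        Node00.OpsYLocalInverse.cubeProjY i (dirDomY i c) =
      deltaPrimeACubeY i c par (fun _ _ => 1) - deltaPrimeACubeY i c par (cutCfgS i (dirDomY i c) (kGeo i).eta A))
    (hunit : IsUnit (padDeltaCubeY i c par (dirDomY i c) (cutCfgS i (dirDomY i c) (kGeo i).eta A))) :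
    (DpDirK b i c par - VpDirK b i c par A) * GpDirVK b i c par A = 1 := by
  have hη2 : ((kGeo i).eta ^ 2 : ℝ) ≠ 0 := pow_ne_zero 2 (eta_ne_zero i)
  rw [DpDirK_sub_VpDirK b i c par A h, GpDirVK, ← B9Eq352DivFormLetters.conj_mul, smul_mul_smul_comm, inv_mul_cancel₀ hη2, one_smul, Module.End.mul_eq_comp,
    ← LinearMap.restrictScalars_comp, ← Module.End.mul_eq_comp, Ring.mul_inverse_cancel _ hunit]
  exact conj_one' b

/-- ★★ **THE IDENTIFICATION `G′_□,ext = conj b(η²(padΔ_{□,Ω₀}(Ṽ))⁻¹)`**: Theorem 3.4's extension at the padded Dirichlet letter, once a two-sided inverse of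
`Δp − V′_□(Ã) = conj b(η⁻²padΔ_{□,Ω₀}(Ṽ))` (Sect. B's conclusions (1)–(2)), IS the padded inverse at the small field, and `padΔ_{□,Ω₀}(Ṽ)` is then a unit.
[cite: Balaban1985BackgroundPropagators, Thm 3.4 p.400 («G′(U′U) = (Δ′_a(U′U))⁻¹ exists»), (3.64)–(3.65) p.402, Cor. 3.6 p.408, p.409 l.1–5] -/
theorem GextDirK_eq_GpDirVK (A : AfldY 𝔸 i)
    (h : Node00.OpsYLocalInverse.cubeProjY i (dirDomY i c) *
        (deltaPrimeACubeY i c par (fun _ _ => 1) - deltaPrimeACubeY i c par (cutCfgS i (dirDomY i c) (kGeo i).eta A)) *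
        Node00.OpsYLocalInverse.cubeProjY i (dirDomY i c) =
      deltaPrimeACubeY i c par (fun _ _ => 1) - deltaPrimeACubeY i c par (cutCfgS i (dirDomY i c) (kGeo i).eta A))
    (h1 : (DpDirK b i c par - VpDirK b i c par A) * GextDirK b i c par A = 1) (h2 : GextDirK b i c par A * (DpDirK b i c par - VpDirK b i c par A) = 1) :
    IsUnit (padDeltaCubeY i c par (dirDomY i c) (cutCfgS i (dirDomY i c) (kGeo i).eta A)) ∧ GextDirK b i c par A = GpDirVK b i c par A := by
  have h1' := h1
  have h2' := h2
  rw [DpDirK_sub_VpDirK b i c par A h] at h1' h2'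
  have hunit : IsUnit (padDeltaCubeY i c par (dirDomY i c) (cutCfgS i (dirDomY i c) (kGeo i).eta A)) :=
    isUnit_of_conj_laws b _ (inv_ne_zero (pow_ne_zero 2 (eta_ne_zero i))) _ h1' h2'
  refine ⟨hunit, ?_⟩
  calc GextDirK b i c par A = (GpDirVK b i c par A * (DpDirK b i c par - VpDirK b i c par A)) * GextDirK b i c par A := by
        rw [GpDirVK_mul_sub b i c par A h hunit, one_mul]
    _ = GpDirVK b i c par A := by rw [mul_assoc, h1, mul_one]

end Letters

/-! ## §2  ★★★ Everything at the small field of a (3.35) datum covering `Ω₀(□)`: the cube-side package for `G′_□(Uᵘ)` at the (β) letter `parKnitCubeY` -/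

section AtDatum

open scoped Matrix.Norms.L2Operator

variable {N : ℕ} [Nonempty (Fin N)]
variable {ι : Type} [Fintype ι] [DecidableEq ι] (b : Module.Basis ι ℝ (Matrix (Fin N) (Fin N) ℂ))

/-- a row of length `> η` has positive cube level (`len = L^{lev_□}η`, `L ≥ 2`). [cite: Balaban1985BackgroundPropagators, (3.41) p.397, bookkeeping] -/
theorem one_le_levCubeY_of_eta_lt (i : KIdx d ℓ hd hL b₀ b₁) (c : ↥(cubes (toKT i).D.toDomains)) {z : SiteY i}
    (hz : (kGeo i).eta < (geoCK i c).len (blkCubeY i c z)) : 1 ≤ levCubeY i c z := by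
  by_contra h0
  have h0' : levCubeY i c z = 0 := by omega
  rw [(geoCK_len_blkCubeY i c z).1, h0', pow_zero, one_mul] at hz
  exact lt_irrefl _ hz

/-- ★★★ **COROLLARY 3.6 AT ONE COVER CUBE ON ROAD P4 — THE CUBE-SIDE PACKAGE FOR PRINT's DIRICHLET LETTER `G′_□(Uᵘ)` AT THE CUBE-LEVEL KNIT LEGS** — uniformly in
the member and the cube: there are `δ₀, B_G > 0`, thresholds `M₀, T₀, N₀`, Theorem 3.4's `a₁ > 0` and `B ≥ 0` (functions of `d, L`, the basis datum `M₂`) such that for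
every member above the thresholds, every cover cube `□`, every letter `Rr, H` of the target geometry and every (3.35) datum `(u, A)` on a V1 set `Q` CONTAINING THE
CHART PREIMAGE OF `Ω₀(□)` with `Uᵘ = e^{iηA}` on the bonds of `Q`, `‖A‖ ≤ Cξ⁻¹`, `‖η⁻¹∂A‖ ≤ Cξ⁻²` there, a datum scale `η ≤ ξ` with `L^{n+1}η ≤ Λξ`, `1 ≤ Λ`,
the GEOMETRY «the 2-step stencil of every site of positive cube level lies in `Ω₀(□)`» (print's collars, p. 408), the (3.37) size `α₁ := 2CΛ² ≤ min(a₁, ¼)` and p06's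
window numerics for the knit legs:
(i) `padΔ_{□,Ω₀}(Ṽ)` is a unit at `parKnitCubeY` for the small field `Ṽ = Uᵘ·𝟙[bond ⊂ Ω₀] = e^{iηÃ}·1`, Theorem 3.4's extension IS the padded inverse there
(`GextDirK = GpDirVK`), `padΔ_{□,Ω₀}(Ṽ) = padΔ_{□,Ω₀}(Uᵘ)` (so the latter is a unit) and `G′_□(Ṽ) = G′_□(Uᵘ)`;
(ii) the two located thresholds at the rate `δ₀`; (iii) the base entries at `U = 1` for `Gp = conj b(η²(padΔ(1))⁻¹)`;
(iv) the (3.37) readings of `Ã` against the cube lengths and the (3.59) sizes of `kF`, `sF` at `parKnitCubeY` (`C_q^K`);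
(v) the two TRANSFER CLAUSES for `conj b(η²(padΔ_{□,Ω₀}(Ṽ))⁻¹)` at `(B, 9δ₀/10)`.
r05's `B9Cor36GpCubeExtAtV.gp_cube_at_locCfg` for the Dirichlet letter and the knit legs; the datum box is DISPLAYED (print: `Ω₀(□) ⊂ □⁵ ⊂` a (3.35) cube of 12 big
blocks, p. 408 — its supply from the member's `Reg335` class is a separate unit).
[cite: Balaban1985BackgroundPropagators, Cor. 3.6 p.408, Cor. 3.5 p.407, Thm 3.4 p.400, (3.64)–(3.65) p.402, p.408 («Ω₀(□) ⊂ □⁵»), p.409 l.1–5, Thm 3.1 (3.42) p.397, (3.35)–(3.37) p.396, (3.58)–(3.60) p.402, p.394] -/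
theorem gpDir_cube_at_field (d ℓ : ℕ) (hℓ : 1 ≤ ℓ) (M₂ : ℝ) (hM₂ : 0 ≤ M₂) (hrepr : ∀ (v : Matrix (Fin N) (Fin N) ℂ) (j : ι), |b.repr v j| ≤ M₂ * ‖v‖) :
    ∃ δ₀ BG M₀ T₀ : ℝ, ∃ N₀ : ℕ, 0 < δ₀ ∧ 0 < BG ∧ ∃ a₁ : ℝ, 0 < a₁ ∧ ∃ B : ℝ, 0 ≤ B ∧
    ∀ {hd : 1 ≤ d + 1} {hL : Odd (ℓ + 1) ∧ 1 < ℓ + 1} {b₀ b₁ : ℝ} (i : KIdx d ℓ hd hL b₀ b₁) (c : ↥(cubes (toKT i).D.toDomains)) (Rr : ℝ) (H : Prop),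
      M₀ ≤ ((ℓ : ℝ) + 1) * (toKT i).Mh → N₀ + 1 ≤ (toKT i).R * ((ℓ + 1) * (toKT i).Mh) → T₀ ≤ RM1 i →
    ∀ (g : GaugeY (Matrix (Fin N) (Fin N) ℂ) i) (U : CfgY (Matrix (Fin N) (Fin N) ℂ) i) (A : AfldY (Matrix (Fin N) (Fin N) ℂ) i)
      (Q : Set (Site (PV d ℓ i.m i.K hd hL) 0)) (C ξ Λ α₀' : ℝ),
      0 ≤ C → (kGeo i).eta ≤ ξ → 1 ≤ Λ → LatticeNorms.scaleLen ((ℓ : ℝ) + 1) (kGeo i).eta (c.1.1 + 1) ≤ Λ * ξ →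
      (∀ z ∈ dirDomY i c, (boxEquiv i.hN).symm z ∈ Q) →
      (∀ (κ : Fin (d + 1)) (x : Site (PV d ℓ i.m i.K hd hL) 0), x ∈ Q → x.shift κ ∈ Q → gaugeY i g U κ x = fluct (kGeo i).eta A κ x) →
      (∀ κ, ∀ x ∈ Q, ‖A κ x‖ ≤ C * ξ⁻¹) →
      (∀ μ ν, ∀ x ∈ Q, ‖(((kGeo i).eta : ℂ)⁻¹) • covD (shiftsV1 (PV d ℓ i.m i.K hd hL)) (fun _ _ => (1 : (Matrix (Fin N) (Fin N) ℂ)ˣ)) μ (A ν) x‖ ≤ C * (ξ ^ 2)⁻¹) →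
      (∀ z : SiteY i, 1 ≤ levCubeY i c z → z ∈ dirDomY i c ∧ ∀ μ, shiftY i μ z ∈ dirDomY i c ∧ (shiftY i μ).symm z ∈ dirDomY i c ∧
        ∀ ν, shiftY i ν (shiftY i μ z) ∈ dirDomY i c ∧ shiftY i ν ((shiftY i μ).symm z) ∈ dirDomY i c ∧ (shiftY i ν).symm ((shiftY i μ).symm z) ∈ dirDomY i c) →
      2 * C * Λ ^ 2 ≤ a₁ → 2 * C * Λ ^ 2 ≤ 1 / 4 →
      0 < α₀' → C0 (d + 1) * α₀' ≤ 1 / 3 → 4 * α₀' ≤ c2' (d + 1) (ℓ + 1) →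
      Real.exp (4 * (800 * (((d + 1 : ℕ) : ℝ) + 1) ^ 2 * (((d + 1 : ℕ) : ℝ) + 4)) * α₀') * (1 + 8 * (131072 * (((d + 1 : ℕ) : ℝ) + 1) ^ 2) * (2 * C * Λ ^ 2)) ≤ 2 →
      2 * (2 * C * Λ ^ 2) ≤ c3 (d + 1) (ℓ + 1) → 4096 * ((d + 1 : ℕ) : ℝ) * (2 * C * Λ ^ 2) ≤ 1 →
      ((IsUnit (padDeltaCubeY i c (parKnitCubeY i c) (dirDomY i c) (cutCfgS i (dirDomY i c) (kGeo i).eta A)) ∧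
          GextDirK b i c (parKnitCubeY i c) A = GpDirVK b i c (parKnitCubeY i c) A) ∧
        padDeltaCubeY i c (parKnitCubeY i c) (dirDomY i c) (cutCfgS i (dirDomY i c) (kGeo i).eta A) =
          padDeltaCubeY i c (parKnitCubeY i c) (dirDomY i c) (gaugeY i g U) ∧
        IsUnit (padDeltaCubeY i c (parKnitCubeY i c) (dirDomY i c) (gaugeY i g U)) ∧
        GpDirY i c (parKnitCubeY i c) (dirDomY i c) (cutCfgS i (dirDomY i c) (kGeo i).eta A) = GpDirY i c (parKnitCubeY i c) (dirDomY i c) (gaugeY i g U)) ∧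
      (4 * Real.log ((ℓ : ℝ) + 1) / (9 / 5000 * δ₀) ≤ RM1 i ∧ N1 d ℓ (9 / 5000 * δ₀) + 1 ≤ (toKT i).R * ((ℓ + 1) * (toKT i).Mh)) ∧
      (HasMajorant (g := toB6 (geoCK i c) Rr H) (fun p : SiteY i × ι => blkCubeY i c p.1) (GpDirK b i c (parKnitCubeY i c))
          (fun a a' => BG * (geoCK i c).len a ^ 2 * Real.exp (-(δ₀ * (geoCK i c).dist a a'))) ∧
        (∀ k : Fin (d + 1) ⊕ Fin (d + 1), HasMajorant (g := toB6 (geoCK i c) Rr H) (fun p : SiteY i × ι => blkCubeY i c p.1)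
          (conj b (diffLetter (shiftY i) (fun _ _ => (1 : (Matrix (Fin N) (Fin N) ℂ)ˣ)) ((((geoCK i c).eta : ℂ))⁻¹) k) * GpDirK b i c (parKnitCubeY i c))
          (fun a a' => BG * (geoCK i c).len a * Real.exp (-(δ₀ * (geoCK i c).dist a a')))) ∧
        (∀ k : Fin (d + 1) ⊕ Fin (d + 1), HasMajorant (g := toB6 (geoCK i c) Rr H) (fun p : SiteY i × ι => blkCubeY i c p.1)
          (GpDirK b i c (parKnitCubeY i c) * conj b (diffLetter (shiftY i) (fun _ _ => (1 : (Matrix (Fin N) (Fin N) ℂ)ˣ)) ((((geoCK i c).eta : ℂ))⁻¹) k))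
          (fun a a' => BG * (geoCK i c).len a * Real.exp (-(δ₀ * (geoCK i c).dist a a'))))) ∧
      ((∀ k x, ‖chartA i (cutFldS i (dirDomY i c) A) k x‖ ≤ 2 * C * Λ ^ 2 * ((geoCK i c).len (blkCubeY i c x))⁻¹) ∧
        (∀ ν k x, ‖tauB (shiftY i) (fun _ _ => (1 : (Matrix (Fin N) (Fin N) ℂ)ˣ)) ν (chartA i (cutFldS i (dirDomY i c) A) k) x‖ ≤
          2 * C * Λ ^ 2 * ((geoCK i c).len (blkCubeY i c x))⁻¹) ∧
        (∀ (y : BlkCubeY i c) (x : SiteY i), blkCubeY i c x = y →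
          ‖kFCubeY i c (parKnitCubeY i c) (fun _ _ => 1) (cutCfgS i (dirDomY i c) (kGeo i).eta A) y x‖ ≤ CqK d * (2 * C * Λ ^ 2) * wK i c y) ∧
        (∀ x : SiteY i, ‖sFCubeY i c (parKnitCubeY i c) (fun _ _ => 1) (cutCfgS i (dirDomY i c) (kGeo i).eta A) x‖ ≤ CqK d * (2 * C * Λ ^ 2))) ∧
      (∀ (X : Module.End ℝ (SiteY i × ι → ℝ)) (P : BlkCubeY i c → ℝ), (∀ y, 0 ≤ P y) →
        HasMajorant (g := toB6 (geoCK i c) Rr H) (fun p : SiteY i × ι => blkCubeY i c p.1) (X * GpDirK b i c (parKnitCubeY i c))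
          (fun a a' => BG * P a * Real.exp (-(δ₀ * (geoCK i c).dist a a'))) →
        HasMajorant (g := toB6 (geoCK i c) Rr H) (fun p : SiteY i × ι => blkCubeY i c p.1) (X * GpDirVK b i c (parKnitCubeY i c) A)
          (fun a a' => B * P a * Real.exp (-(9 / 10 * δ₀ * (geoCK i c).dist a a')))) ∧
      (∀ Y : Module.End ℝ (SiteY i × ι → ℝ),
        HasMajorant (g := toB6 (geoCK i c) Rr H) (fun p : SiteY i × ι => blkCubeY i c p.1) (GpDirK b i c (parKnitCubeY i c) * Y)
          (fun a a' => BG * (geoCK i c).len a * Real.exp (-(δ₀ * (geoCK i c).dist a a'))) →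
        HasMajorant (g := toB6 (geoCK i c) Rr H) (fun p : SiteY i × ι => blkCubeY i c p.1) (GpDirVK b i c (parKnitCubeY i c) A * Y)
          (fun a a' => B * (geoCK i c).len a * Real.exp (-(9 / 10 * δ₀ * (geoCK i c).dist a a')))) := by
  letI : CStarAlgebra (Matrix (Fin N) (Fin N) ℂ) := {}
  have h1A : ‖(1 : Matrix (Fin N) (Fin N) ℂ)‖ ≤ 1 := norm_one.le
  obtain ⟨δ₀, BG, M₀, T₀, N₀, hδ₀, hBG, a₁, ha₁, B, hB, Hmain⟩ := cor35_GpDir_cube b d ℓ hℓ (CqK d) M₂ (CqK_nonneg d) hM₂ hrepr h1A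
  refine ⟨δ₀, BG, M₀, T₀, N₀, hδ₀, hBG, a₁, ha₁, B, hB, ?_⟩
  intro hd hL b₀ b₁ i c Rr H hM hN hT g U A Q C ξ Λ α₀' hC hξ hΛ hΛξ hQ hgA hA hdA hS2 hα₁ hα4 hα' hα3 hα4' hsmall hc₃ hsm
  set η : ℝ := (kGeo i).eta with hηdef
  have hη : 0 < η := by rw [hηdef, ← geoCK_eta i c]; exact geoCK_eta_pos i c
  set α₁ : ℝ := 2 * C * Λ ^ 2 with hα₁def
  have hα₁0 : 0 ≤ α₁ := by rw [hα₁def]; positivity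
  -- the length function of the engine at the cube blocks is `L^{n(z)}η`
  have hL1 : (1 : ℝ) ≤ (ℓ : ℝ) + 1 := by linarith [(Nat.cast_nonneg ℓ : (0 : ℝ) ≤ ℓ)]
  have hlenS : ∀ z : SiteY i, (geoCK i c).len (blkCubeY i c z) = LatticeNorms.scaleLen ((ℓ : ℝ) + 1) η (levCubeY i c z) := fun z => by
    rw [(geoCK_len_blkCubeY i c z).1]; rfl
  have hlenη : ∀ z : SiteY i, η ≤ (geoCK i c).len (blkCubeY i c z) := fun z => by
    rw [(geoCK_len_blkCubeY i c z).1]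
    exact le_mul_of_one_le_left hη.le (one_le_pow₀ hL1)
  have hlenΛ : ∀ z : SiteY i, (geoCK i c).len (blkCubeY i c z) ≤ Λ * ξ := fun z => by
    rw [hlenS]; exact (scaleLen_levCubeY_bounds i c hL1 hη hΛξ z).2
  -- `Ω₀(□) ⊇ {lev_□ ≥ 1}` (g31) and the 2-step stencil geometry (displayed) in the readings' form
  have hS1 : ∀ z : SiteY i, 1 ≤ levCubeY i c z → z ∈ dirDomY i c := fun z hz => mem_dirDomC_of_lev_pos hL.1 (oddMh i) (toKT i).hMh (toKT i).hP c hz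
  have hS2' : ∀ z : SiteY i, η < (geoCK i c).len (blkCubeY i c z) → z ∈ dirDomY i c ∧ ∀ μ, shiftY i μ z ∈ dirDomY i c ∧ (shiftY i μ).symm z ∈ dirDomY i c ∧
      ∀ ν, shiftY i ν (shiftY i μ z) ∈ dirDomY i c ∧ shiftY i ν ((shiftY i μ).symm z) ∈ dirDomY i c ∧ (shiftY i ν).symm ((shiftY i μ).symm z) ∈ dirDomY i c :=
    fun z hz => hS2 z (one_le_levCubeY_of_eta_lt i c hz)
  -- the five (3.37) readings of the cut potential (UNIT 5)
  obtain ⟨r1, r2, r3, r4, r5⟩ := readings337_cutFldS i hC hη hξ hΛ hQ hA hdA (fun z => (geoCK i c).len (blkCubeY i c z)) hlenη hlenΛ hS2'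
  -- the (3.59) kernel sizes at the cube knit legs (UNIT 4), own-level form of the (3.37) reading
  have hown := ownLevel_of_blockwise i c hη (cutFldS i (dirDomY i c) A) (α₁ := α₁) (fun k x => by
    have h := r4 k x
    rw [(geoCK_len_blkCubeY i c x).1, levCubeY_eq] at h
    push_cast
    exact h)
  have hkF : ∀ (y : BlkCubeY i c) (x : SiteY i), blkCubeY i c x = y →
      ‖kFCubeY i c (parKnitCubeY i c) (fun _ _ => 1) (cutCfgS i (dirDomY i c) η A) y x‖ ≤ CqK d * α₁ * wK i c y :=
    fun y x hx => norm_kFCubeY_parKnitCubeY_one_le i c hα' hα3 hα4' hη.le hα₁0 hsmall hc₃ hsm (cutFldS i (dirDomY i c) A) y (hown y) x hx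
  have hsF : ∀ x : SiteY i, ‖sFCubeY i c (parKnitCubeY i c) (fun _ _ => 1) (cutCfgS i (dirDomY i c) η A) x‖ ≤ CqK d * α₁ :=
    fun x => norm_sFCubeY_parKnitCubeY_one_le i c hα' hα3 hα4' hη.le hα₁0 hsmall hc₃ hsm (cutFldS i (dirDomY i c) A) x (hown (blkCubeY i c x))
  -- Theorem 3.4 at the padded Dirichlet letter (UNIT 2): the two-sided inverse and the transfer clauses
  have hparone : ∀ z w : SiteY i, parKnitCubeY i c (fun _ _ => (1 : (Matrix (Fin N) (Fin N) ℂ)ˣ)) z w = 1 := fun z w => parKnitCubeY_one i c z w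
  obtain ⟨hthr, hbase, hL34, hR34, Heng⟩ := Hmain i c Rr H (parKnitCubeY i c) hparone hM hN hT
  obtain ⟨l1, l2, l3, l4⟩ := Heng α₁ hα₁0 hα₁ (chartA i (cutFldS i (dirDomY i c) A))
    (kFCubeY i c (parKnitCubeY i c) (fun _ _ => 1) (cutCfgS i (dirDomY i c) η A)) (sFCubeY i c (parKnitCubeY i c) (fun _ _ => 1) (cutCfgS i (dirDomY i c) η A))
    hkF hsF (fun ν k x => by rw [geoCK_eta]; exact r1 ν k x) (fun μ ν x => by rw [geoCK_eta]; exact r2 μ ν x)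
    (fun μ x => by rw [geoCK_eta]; exact r3 μ x) r4 r5
  -- (i): the unit, the identification, and `Ṽ ↦ Uᵘ` for the padded letters (UNIT 5a)
  have hcompr := compr_sub_compr_eq_cutCfgS i c hS1 η A
  have hid := GextDirK_eq_GpDirVK b i c (parKnitCubeY i c) A hcompr l1 l2
  have hpad := padDeltaCubeY_cutCfgS_eq_gaugeY i c hS1 (η := η) (A := A) hQ hgA
  have hGp := GpDirY_cutCfgS_eq_gaugeY i c hS1 (η := η) (A := A) hQ hgA
  refine ⟨⟨hid, hpad, by rw [← hpad]; exact hid.1, hGp⟩, hthr, ⟨hbase, hL34, hR34⟩, ⟨r4, r5, hkF, hsF⟩, fun X P hP hX => ?_, fun Y hY => ?_⟩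
  · have h := l3 X P hP hX
    change HasMajorant (g := toB6 (geoCK i c) Rr H) (fun p : SiteY i × ι => blkCubeY i c p.1) (X * GextDirK b i c (parKnitCubeY i c) A) _ at h
    rwa [hid.2] at h
  · have h := l4 Y hY
    change HasMajorant (g := toB6 (geoCK i c) Rr H) (fun p : SiteY i × ι => blkCubeY i c p.1) (GextDirK b i c (parKnitCubeY i c) A * Y) _ at h
    rwa [hid.2] at h

omit [Nonempty (Fin N)] [DecidableEq ι] in
/-- ★ **(3.42)₁ FOR `conj b(η²(padΔ_{□,Ω₀}(Ṽ))⁻¹)` OVER THE CUBE SEQUENCE's BLOCKS** (the transfer clause at `X := 1`, `P := (Lⁿη)²`).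
[cite: Balaban1985BackgroundPropagators, Cor. 3.6 p.408, Thm 3.1 (3.42)₁ p.397, p.409 l.1–5, Thm 3.4 p.400] -/
theorem hasMajorant_GpDirVK (i : KIdx d ℓ hd hL b₀ b₁) (c : ↥(cubes (toKT i).D.toDomains)) (par : SiteParY (Matrix (Fin N) (Fin N) ℂ) i) (Rr : ℝ) (H : Prop)
    (A : AfldY (Matrix (Fin N) (Fin N) ℂ) i) {BG B δ₀ : ℝ}
    (hbase : HasMajorant (g := toB6 (geoCK i c) Rr H) (fun p : SiteY i × ι => blkCubeY i c p.1) (GpDirK b i c par)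
      (fun a a' => BG * (geoCK i c).len a ^ 2 * Real.exp (-(δ₀ * (geoCK i c).dist a a'))))
    (hX : ∀ (X : Module.End ℝ (SiteY i × ι → ℝ)) (P : BlkCubeY i c → ℝ), (∀ y, 0 ≤ P y) →
      HasMajorant (g := toB6 (geoCK i c) Rr H) (fun p : SiteY i × ι => blkCubeY i c p.1) (X * GpDirK b i c par)
        (fun a a' => BG * P a * Real.exp (-(δ₀ * (geoCK i c).dist a a'))) →
      HasMajorant (g := toB6 (geoCK i c) Rr H) (fun p : SiteY i × ι => blkCubeY i c p.1) (X * GpDirVK b i c par A)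
        (fun a a' => B * P a * Real.exp (-(9 / 10 * δ₀ * (geoCK i c).dist a a')))) :
    HasMajorant (g := toB6 (geoCK i c) Rr H) (fun p : SiteY i × ι => blkCubeY i c p.1) (GpDirVK b i c par A)
      (fun a a' => B * (geoCK i c).len a ^ 2 * Real.exp (-(9 / 10 * δ₀ * (geoCK i c).dist a a'))) := by
  have h := hX 1 (fun a => (geoCK i c).len a ^ 2) (fun a => sq_nonneg _) (by rw [one_mul]; exact hbase)
  rwa [one_mul] at h

end AtDatum

end Literature.MathematicalPhysics.QuantumFieldTheory.Balaban1983to89.B9Cor36GpDirExtAtField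

end
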